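import Summits.QuantumFields.YangMills.Theses.ThermodynamicCeilings

/-!
# Route `ThermodynamicCeilings` — the edge `TopBandCeilingC → TopBandPointCeiling` (LINE E is a WEAKENING)

D-0145 ideator seat ym-idea-11 (g5, lens «wuc»).  The crux `TopBandPointCeiling` (stmt-QuantumFields-27770) is the single-separation
instance `t = 2R₂+2` of the band statement `TopBandCeilingC` (stmt-QuantumFields-27690, by name
`AntiScreeningCeilings.TopBandCeiling`, band `2R₂+2 ≤ t ≤ L`); together with the support `MirrorMonotoneDecay` it gives the band
back (`TopBandPointGlue`, landed p632861).  This file records the trivial direction, certifying that LINE E's crux is weaker than the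
statement it replaces.  An implication between two OPEN items; closes nothing; no summit / leaf / NT / UV / IR statement is proved.
-/

namespace Summit.QuantumFields.YangMills.Theses.ThermodynamicCeilings

/-- **The edge**: the band ceiling implies the point ceiling (instance `t = 2R₂+2`, admissible since `4R₂+8 ≤ L`). -/
theorem topBandPointCeiling_of_topBandCeilingC : TopBandCeilingC → TopBandPointCeiling := by
  intro hB G _ _ _ _ hG hiso r v f g h Λ₅
  letI : MeasurableSpace G := borel G
  haveI : BorelSpace G := ⟨rfl⟩
  obtain ⟨ε₀, hε₀, hmain⟩ := hB G hG hiso r v f g h Λ₅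
  refine ⟨ε₀, hε₀, fun ε hε hεε hfl => ?_⟩
  obtain ⟨ℓ₄, hℓ₄, hℓ⟩ := hmain ε hε hεε hfl
  refine ⟨ℓ₄, hℓ₄, fun ℓ hℓ0 hℓℓ => ?_⟩
  obtain ⟨C, β₄, hC, hβ⟩ := hℓ ℓ hℓ0 hℓℓ
  refine ⟨C, β₄, hC, fun β hββ s hs0 hs1 hsub hnear L q k R₂ hq hR hRs hL hℓR => ?_⟩
  exact hβ β hββ s hs0 hs1 hsub hnear L q k R₂ (2 * R₂ + 2) hq hR hRs hL hℓR le_rfl (by omega)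

end Summit.QuantumFields.YangMills.Theses.ThermodynamicCeilings
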